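import Mathlib
import Literature.Analysis.FluidPDE.SuitableWeak
import Literature.Analysis.FluidPDE.SelfSimilar
import Literature.Analysis.FluidPDE.LocalTypeI
import Summits.NavierStokesRegularity.NavierStokesRegularity.Theses.RellichScar

/-!
# Sketch — first lemmas of crux idea `russian-doll-multiplicity` for `RellichScar.ApexLocalisation`
(stmt-NavierStokesRegularity-11719; planner-cruxidea …-11719-5-0, round 2).

Only statements (`def … : Prop`), over existing declarations; nothing is proved here.

* `ApexConclusion`      — the conclusion of the crux, verbatim shape.
* `SliceWeakL3 M u`     — `sup_{t<0} ‖u(t)‖³_{L^{3,∞}(ℝ³)} ≤ M` in distribution-function form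
                          (= "bounded lump multiplicity" under the Type-I rate).
* `WeakL3Localisation`  — FIRST LEMMA (the provable special case): a rate-Type-I singular slab
                          profile with `𝐈 < ⊤` and a uniform weak-`L³` slice bound yields an apex
                          profile (Russian-doll / nested-flare argument + `orbitDichotomy`).
* `WeakL3Selection`     — the residual bet (∃-form).
* `CruxIffWeakL3Selection` — the certified-shape equivalence the line would land.
-/

namespace Summit.NavierStokesRegularity.NavierStokesRegularity.Cruxes.ApexLocalisation.RussianDoll

open MeasureTheory Set Function Metric Filter
open scoped ENNReal Topology

open Literature.Analysis.FluidPDE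

local notation "E³" => EuclideanSpace ℝ (Fin 3)

/-- The slab `(-∞,0) × ℝ³` (time first), as in the route file. -/
noncomputable abbrev negSlab : TopologicalSpace.Opens (ℝ × E³) := slab E³ (Iio 0) isOpen_Iio

/-- Conclusion of `ApexLocalisation`, verbatim shape: an apex-class profile singular at the origin. -/
def ApexConclusion : Prop :=
  ∃ (C' : ℝ) (u : ℝ → E³ → E³) (p : ℝ → E³ → ℝ) (G : ℝ → E³ → E³ →L[ℝ] E³),
    IsSuitableWeakSolutionOn negSlab 1 0 u p ∧ HasWeakSpatialGradientOn negSlab u G ∧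
    typeIBound (Iio (0 : ℝ) ×ˢ univ) u p G < ⊤ ∧ HasTypeIDecay C' u ∧ IsBackwardSingularPoint u 0

/-- **Uniform weak-`L³` slice bound** (`L^∞_t L^{3,∞}_x`, Choe–Wolf–Yang 2019 / Barker 2024 class),
in distribution-function form: `h³ · |{x : ‖u(t,x)‖ > h}| ≤ M` for every `t < 0`, `h > 0`.
Under the rate `‖u‖ ≤ C/√(−t)` this is, up to constants, a bound on the LUMP MULTIPLICITY:
the number of disjoint balls `B(xᵢ, √(−t))` carrying Type-I activity `√(−t)‖u‖ ≥ η` at time `t`. -/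
def SliceWeakL3 (M : ℝ) (u : ℝ → E³ → E³) : Prop :=
  ∀ t : ℝ, t < 0 → ∀ h : ℝ, 0 < h →
    ENNReal.ofReal (h ^ 3) * volume {x : E³ | h < ‖u t x‖} ≤ ENNReal.ofReal M

/-- **FIRST LEMMA — weak-`L³` Type-I profiles localise** (the provable special case of the lead's
input (i)): if a suitable weak slab solution with `𝐈 < ⊤`, the RATE `‖u‖ ≤ C/√(−t)`, a singular
origin AND a uniform weak-`L³` slice bound exists, then an apex-class singular profile exists.
Proof route (Russian doll): were no element of the translation–scaling closure apex, the
orbit-closure dichotomy (`orbitDichotomy`, tree) gives long-lived parabolically separated flares;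
a long-lived flare is, in the limit, an exact Type-I point, hence (no apex anywhere) carries its own
long-lived sub-flares INSIDE its life-span; nesting `m` levels gives `m` simultaneous disjoint
`η₀`-lumps on a common time window, so `h³|{‖u(t)‖>h}| ≳ m η₀³` — contradiction for `m` large. -/
def WeakL3Localisation : Prop :=
  ∀ (C M : ℝ),
    (∃ (u : ℝ → E³ → E³) (p : ℝ → E³ → ℝ) (G : ℝ → E³ → E³ →L[ℝ] E³),
      IsSuitableWeakSolutionOn negSlab 1 0 u p ∧ HasWeakSpatialGradientOn negSlab u G ∧
      typeIBound (Iio (0 : ℝ) ×ˢ univ) u p G < ⊤ ∧ HasTypeITimeDecay C u ∧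
      IsBackwardSingularPoint u 0 ∧ SliceWeakL3 M u) →
    ApexConclusion

/-- **The residual bet (∃-form, class change only): WEAK-`L³` SELECTION.** If a rate-Type-I singular
slab profile exists, then one (possibly unrelated, any constants) exists whose slices are uniformly
in weak-`L³`. Apex profiles satisfy it (`‖u‖ ≤ C'/‖x‖ ∈ L^{3,∞}`), so with `WeakL3Localisation`
the bet is EQUIVALENT to the crux. -/
def WeakL3Selection : Prop :=
  ∀ C : ℝ,
    (∃ (u : ℝ → E³ → E³) (p : ℝ → E³ → ℝ) (G : ℝ → E³ → E³ →L[ℝ] E³),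
      IsSuitableWeakSolutionOn negSlab 1 0 u p ∧ HasWeakSpatialGradientOn negSlab u G ∧
      typeIBound (Iio (0 : ℝ) ×ˢ univ) u p G < ⊤ ∧ HasTypeITimeDecay C u ∧
      IsBackwardSingularPoint u 0) →
    ∃ (C₁ M : ℝ) (u : ℝ → E³ → E³) (p : ℝ → E³ → ℝ) (G : ℝ → E³ → E³ →L[ℝ] E³),
      IsSuitableWeakSolutionOn negSlab 1 0 u p ∧ HasWeakSpatialGradientOn negSlab u G ∧
      typeIBound (Iio (0 : ℝ) ×ˢ univ) u p G < ⊤ ∧ HasTypeITimeDecay C₁ u ∧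
      IsBackwardSingularPoint u 0 ∧ SliceWeakL3 M u

/-- **Apex ⇒ weak-`L³`** (the easy converse feeding the equivalence): the space–time Type-I bound
puts every slice in weak-`L³` with `M = (4/3)π C'³`. -/
def ApexGivesSliceWeakL3 : Prop :=
  ∀ (C' : ℝ) (u : ℝ → E³ → E³), HasTypeIDecay C' u → SliceWeakL3 (4 / 3 * Real.pi * C' ^ 3) u

/-- The normal form the line would certify: crux ⇔ weak-`L³` selection. -/
def CruxIffWeakL3Selection : Prop :=
  Summit.NavierStokesRegularity.NavierStokesRegularity.Theses.RellichScar.ApexLocalisation ↔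
    WeakL3Selection

/-- Sanity: the first lemma and the bet compose to the crux (pure logic, checked here). -/
theorem apexLocalisation_of_weakL3 (hL : WeakL3Localisation) (hS : WeakL3Selection) :
    Summit.NavierStokesRegularity.NavierStokesRegularity.Theses.RellichScar.ApexLocalisation := by
  intro C hC
  obtain ⟨C₁, M, u, p, G, hsw, hwg, hI, hrate, hsing, hweak⟩ := hS C hC
  obtain ⟨C', v, q, H, hsw', hwg', hI', hdec, hsing'⟩ :=
    hL C₁ M ⟨u, p, G, hsw, hwg, hI, hrate, hsing, hweak⟩
  exact ⟨C', v, q, H, hsw', hwg', hI', hdec, hsing'⟩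

end Summit.NavierStokesRegularity.NavierStokesRegularity.Cruxes.ApexLocalisation.RussianDoll
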